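import Summits.QuantumFields.YangMills.Theorems.BalabanUVNodesN11Sect3SupplyChainObligationsDefs
import Summits.QuantumFields.YangMills.Theorems.BalabanUVNodesN11GaussianCertificateDefs

/-!
# DAG node N11 — THE NODE ALONG THE WITNESS CHAIN: [III]'s Theorem of p. 245 (`B14.ThmP245PrintedI`, this seat's R134 row), `densitiesDescribed`, `Dag.B14_main` and
# `B16.Thm1Printed` at the CoPH datum, keyed to the supplier's obligations along its OWN chain; THEOREM 1 with the no-expansion obligation DISCHARGED — from the rows at a
# generic parameter, from def-T's operand rows ALONE at any Gaussian certificate (`gaussPinH θ` included), and at the H-extensions of the witness of record with the selector,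
# admissibility, the signs and `M = 1` discharged (the Gaussian door of the witness of record: `hrec` + `SupplierObligations` + `OperandRowsAlongChain`, NOTHING ELSE)

Cell `pub-ymgap`, YM-PLAN Track A (HUMAN RULING D-0062 ∕ D-0149), seat `pub-ymgap-dag-n11-e` (g16; R134 fan-out row N11∕s3 «`ThmP245Printed` :375 via `rOperation`»), route
`BalabanUVNodes` rev 25 (v1.7 `CoPH` key), item K1⁷ `StabilityBAtRecordR13SepCoPH` = stmt-QuantumFields-20542 (helper lane, count-neutral).  [III] = [Balaban1988Convergent],
[IV] = [Balaban1989LargeFieldI], [B16] = [Balaban1989LargeFieldII].  Over this seat's `…Sect3SupplyChainObligationsDefs` (the named hand-over list), the knit dictionary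
`B14NodeKnitRecord13RCoPH` ∕ `B16RLeafRecord13LiveCoPH` ∕ def-T's `thm1Printed_datumOfRecord₁₃CoPH_of_tLaw_rOpLeaf`, dag-n11-w1's `…GaussianCertificateDefs` (`gaussPinH`) and
K0a ∕ K0b's witness of record (`theta13LiveOfRecord`, `admissible_theta13LiveOfRecord`, the family's numerals).

WHY THIS FILE.  `…ThmP245OfSect3SupplyCoPH` (p578897) keyed the node on the ∀-exposed-witness predicates `NoExpansionTStepAt ∕ Sect3SupplyAt`; the witness chain
(`…Sect3SupplyChain`, p591271) cured that over-strength by keying every deliverable to the suppliers' OWN terms.  This file re-reads THE NODE along the chain: every face takes the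
two tokens `(hσ : SupplierObligations θ p σ) (hT : NoExpansionObligation θ p σ)` — and then DISCHARGES `hT` (dag-n11-d's lane) wherever the tree can: from `ResidualRows +
OperandRowsAlongChain` at a generic `θ`, from `OperandRowsAlongChain` ALONE at any Gaussian certificate (dag-n11-w1), and at the witness of record.
§1 (generic `θ`, live-selector line) ★ `thmP245PrintedI_of_obligations` (+ `thmP245Printed_of_obligations`, the `RTOp` name) — THIS SEAT's R134 ROW, WITNESS-THREADED: along any `T`-family agreeing with the
   tower, from `(hσ, hT)`; `densitiesDescribed_of_obligations`; `b14_main_of_obligations` (𝐑 read through the leaf on the live line); `thm1Printed_datumOfRecord₁₃CoPH_of_obligations`.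
§2 (generic `θ`) `sLaw₁₃CoPH_all_of_obligations_of_rows` (hT from the rows); ★★ `sLaw₁₃CoPH_all_of_obligations_of_gaussCert` + `thmP245PrintedI_of_obligations_of_gaussCert` (ANY `θ`
   of the Gaussian class: `hσ` + operand rows — no `ZhUnity`, no residual row, no K0b row); ★★ `sLaw₁₃CoPH_all_gaussPinH_of_obligations` (at the NAMED certificate `gaussPinH θ`
   of any `θ` with core provisos on the live line).
§3 (the witness of record) at ANY H-extension `⟨⟨theta13LiveOfRecord F N, Zr⟩, Zh, Phih⟩` — selector `rfl`, `admissible_theta13LiveOfRecord`, `κ, E₀, B₀ ≥ 0` and `M = 1` the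
   family's numerals: ★ `sLaw₁₃CoPH_all_theta13LiveOfRecordH_of_obligations` (from `hrec`, `hσ`, `hT` ONLY) + `tLaw…`; ★ `…_of_rows` (HOME TRIGGERS (t60): `hrec`, `ZhUnity`, `hσ`,
   the rows); ★★★ `sLaw₁₃CoPH_all_gaussCertH_theta13LiveOfRecord_of_obligations_of_operandRows` — THE HONEST STATE OF N11 AT A GAUSSIAN DOOR OF THE WITNESS OF RECORD,
   WITNESS-THREADED: `hrec` (the datum's key) + `SupplierObligations` ([III] §3) + `OperandRowsAlongChain` (def-T), NOTHING ELSE; ★★ `thm1Printed_datumOfRecord₁₃CoPH_theta13LiveOfRecordH_of_obligations`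
   ([B16]'s first conjunct at the datum of any H-extension of the witness of record from `(hσ, hT)` along the windowed runs; the 𝐑-leaf is CLOSED there).

HONEST FRAMING.  Count-neutral kernel composition; `SupplierObligations` ([III] §3 ∕ Thm 2 — nobody's theorem yet), `OperandRowsAlongChain` (def-T), `ResidualRows` (K0b ∕ def-T)
and `hrec` DISPLAYED, never discharged here; nothing of Bałaban asserted; N11 NOT discharged; K1⁷ NOT closed; counts unmoved (typed 28∕28 · discharged 5∕27).  One finite
`𝕋⁴_{L^K}` programme at fixed `ε = L^{−K}`; R4 closes only the conditional finite-𝕋⁴ rung `BalabanLadder.UV` — NOT ℝ⁴, NOT OS, NOT a mass gap, NOT Clay.  No `sorry`, `axiom`,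
`instance`, `notation`.
Sources: [III] Theorem p.245, Thm 1 p.262, remark p.262, Thm 2 p.263, §3 p.279, (3.24)–(3.25) p.270, (3.23) p.270, (3.16)–(3.22) pp.268–269, (1.11) p.248, p.244; [IV] (0.2)–(0.4)
p.176, p.177 (i)–(ii); [B16] Thm 1 p.355 (not exercised).
-/

noncomputable section

open MeasureTheory
open scoped BigOperators ENNReal NNReal Matrix.Norms.L2Operator

namespace Summit.QuantumFields.YangMills.Theorems.BalabanUVNodesN11Sect3SupplyChainNode

open Literature.MathematicalPhysics.QuantumFieldTheory.Balaban1983to89 T4Continuum Node00 Node00.Tk DagBinding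
open Literature.MathematicalPhysics.QuantumFieldTheory.Balaban1983to89.B16RLeafRecord13LiveCoPH (densitiesDescribed_leavesP_iff_sLaw₁₃CoPH_all_datum
  b14_main_at_record₁₃CoPH_of_rOpLeaf rOpLeaf_VOfRecord₁₃CoPH_of_liveSel_of_rstep)
open Literature.MathematicalPhysics.QuantumFieldTheory.Balaban1983to89.B16RLeafRecord13AtLive (kappa_nonneg_theta13LiveOfFamily B0_nonneg_theta13LiveOfFamily
  E0_nonneg_theta13LiveOfFamily)
open Literature.MathematicalPhysics.QuantumFieldTheory.Balaban1983to89.B14NodeKnitRecord13RCoPH (thmP245PrintedI_at_record₁₃CoPH_iff_laws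
  thm1Printed_datumOfRecord₁₃CoPH_theta13LiveOfRecord_of_thmP245I)
open B10Eq42TorusConstraint (bondsIn)
open BalabanUVNodesN11HistoryPinnedResidualDefs (ZhPinOfRecord₁₃)
open BalabanUVNodesN11Sect3SupplyChainDefs (Sect3Supplier chainWitness)
open BalabanUVNodesN11Sect3SupplyChainObligationsDefs
open BalabanUVNodesN11GaussianCertificateDefs (gaussPinH gaussPinH_ζ0 gaussPinH_quad provisos₁₃CoPH_gaussPinH)

variable {F : T4Family} {N : ℕ} [NeZero N]
variable {θ : Stage13HParams F N} {p : B12.RunParams}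

/-! ## §1  The node faces along the chain at a generic `θ`, live-selector line -/

section Node

/-- **★ THIS SEAT's R134 ROW, WITNESS-THREADED — [III]'s THEOREM OF p. 245 `B14.ThmP245PrintedI` ALONG ANY FAMILY `T` OF RENORMALIZATION TRANSFORMATIONS AGREEING WITH THE TOWER
OF RECORD, AT THE STAGE-13 RECORD OF `θ`** (`ρ := densOfRecord₁₃`, the spaces `(VOfRecord₁₃CoPH θ p).S ∕ .Scorr`, `K := p.K`; the knit dictionary
`thmP245PrintedI_at_record₁₃CoPH_iff_laws` over `thmP245Laws_of_obligations`) — FROM the supplier's obligations along its own chain `hσ` and the no-expansion obligation `hT`, on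
the live-selector line (core provisos, selector clause, admissibility, `0 ≤ κ, E₀, B₀`, `1 ≤ M`). [cite: Balaban1988Convergent, Theorem p.245, Thm 1 p.262, remark p.262, (3.25) p.270, §3 p.279] -/
theorem thmP245PrintedI_of_obligations (h : θ.Provisos₁₃CoPH F N)
    (hsel : θ.ppSel = ppSelLiveOfRecord F N θ.ν θ.τ9 (EOfRecord₁₃ F N θ.toStage13Params) (wOfRecord₉ F N θ.toStage9Params))
    (hθ : θ.Admissible F N) (hκ : 0 ≤ θ.s2.lf.κ) (hE₀ : 0 ≤ θ.s2.lf.E₀) (hB₀ : 0 ≤ θ.s2.lf.B₀) (hM : 1 ≤ θ.τ9.M) (σ : Sect3Supplier θ p)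
    (hσ : SupplierObligations θ p σ) (hT : NoExpansionObligation θ p σ)
    (T : (k : ℕ) → RTOpI (F.P p.K) k (SU N) (avOfRecord F N p.K k))
    (hTT : ∀ k, k < p.K → (T k).T (densOfRecord₁₃ F N θ.toStage13Params p k) = tdensOfRecord₁₃ F N θ.toStage13Params p k) :
    B14.ThmP245PrintedI T (densOfRecord₁₃ F N θ.toStage13Params p) (VOfRecord₁₃CoPH F N θ p).S (VOfRecord₁₃CoPH F N θ p).Scorr p.K :=
  (thmP245PrintedI_at_record₁₃CoPH_iff_laws F N θ p T hTT).2 (thmP245Laws_of_obligations h hsel hθ hκ hE₀ hB₀ hM σ hσ hT)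

/-- **… AND IN THE ROW's LITERAL NAME `B14.ThmP245Printed`** (the cell's original carrier `RTOp`; the same Prop along `RTOp.toRTOpI`, `B14.thmP245PrintedI_toRTOpI_iff`) for any
`RTOp`-family agreeing with the tower on the trajectory. [cite: Balaban1988Convergent, Theorem p.245, Thm 1 p.262, remark p.262, (3.25) p.270] -/
theorem thmP245Printed_of_obligations (h : θ.Provisos₁₃CoPH F N)
    (hsel : θ.ppSel = ppSelLiveOfRecord F N θ.ν θ.τ9 (EOfRecord₁₃ F N θ.toStage13Params) (wOfRecord₉ F N θ.toStage9Params))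
    (hθ : θ.Admissible F N) (hκ : 0 ≤ θ.s2.lf.κ) (hE₀ : 0 ≤ θ.s2.lf.E₀) (hB₀ : 0 ≤ θ.s2.lf.B₀) (hM : 1 ≤ θ.τ9.M) (σ : Sect3Supplier θ p)
    (hσ : SupplierObligations θ p σ) (hT : NoExpansionObligation θ p σ)
    (T : (k : ℕ) → RTOp (F.P p.K) k (SU N) (avOfRecord F N p.K k))
    (hTT : ∀ k, k < p.K → (T k).T (densOfRecord₁₃ F N θ.toStage13Params p k) = tdensOfRecord₁₃ F N θ.toStage13Params p k) :
    B14.ThmP245Printed T (densOfRecord₁₃ F N θ.toStage13Params p) (VOfRecord₁₃CoPH F N θ p).S (VOfRecord₁₃CoPH F N θ p).Scorr p.K :=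
  (B14.thmP245PrintedI_toRTOpI_iff T _ _ _ _).1 (thmP245PrintedI_of_obligations h hsel hθ hκ hE₀ hB₀ hM σ hσ hT (fun k => (T k).toRTOpI) hTT)

/-- **N11's NODE SENTENCE `densitiesDescribed` AT A WORLD BOUND TO THE CoPH DATUM OF `θ`** from `(hσ, hT)` — Theorem 1 along the chain read through
`densitiesDescribed_leavesP_iff_sLaw₁₃CoPH_all_datum`. [cite: Balaban1988Convergent, Thm 1 p.262, Theorem p.245, p.244; Balaban1989LargeFieldI, (0.3) p.176, p.177 (i)–(ii)] -/
theorem densitiesDescribed_of_obligations (h : θ.Provisos₁₃CoPH F N)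
    (hsel : θ.ppSel = ppSelLiveOfRecord F N θ.ν θ.τ9 (EOfRecord₁₃ F N θ.toStage13Params) (wOfRecord₉ F N θ.toStage9Params))
    (hθ : θ.Admissible F N) (hκ : 0 ≤ θ.s2.lf.κ) (hE₀ : 0 ≤ θ.s2.lf.E₀) (hB₀ : 0 ≤ θ.s2.lf.B₀) (hM : 1 ≤ θ.τ9.M) (σ : Sect3Supplier θ p)
    (hσ : SupplierObligations θ p σ) (hT : NoExpansionObligation θ p σ) (w : WorldP) (hC : w.C = (datumOfRecord₁₃CoPH F N θ h).C) :
    (leavesP w p).densitiesDescribed :=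
  (densitiesDescribed_leavesP_iff_sLaw₁₃CoPH_all_datum F N θ p w h hC).2 (sLaw₁₃CoPH_all_of_obligations h hsel hθ hκ hE₀ hB₀ hM σ hσ hT)

/-- **N11's DAG NODE `Dag.B14_main (leavesP w p)` AT A WORLD BOUND TO THE CoPH DATUM OF `θ`** from `(hσ, hT)` — the 𝐑-antecedent read through the leaf on the live line
(`rOpLeaf_VOfRecord₁₃CoPH_of_liveSel_of_rstep`), the (S1ᵀ) slot by `thmP245Laws_of_obligations`; the node's other in-edges are not even read.
[cite: Balaban1988Convergent, Thm 1 p.262, Theorem p.245, p.244; Balaban1989LargeFieldI, (0.3) p.176, p.177 (i)–(ii)] -/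
theorem b14_main_of_obligations (h : θ.Provisos₁₃CoPH F N)
    (hsel : θ.ppSel = ppSelLiveOfRecord F N θ.ν θ.τ9 (EOfRecord₁₃ F N θ.toStage13Params) (wOfRecord₉ F N θ.toStage9Params))
    (hθ : θ.Admissible F N) (hκ : 0 ≤ θ.s2.lf.κ) (hE₀ : 0 ≤ θ.s2.lf.E₀) (hB₀ : 0 ≤ θ.s2.lf.B₀) (hM : 1 ≤ θ.τ9.M) (σ : Sect3Supplier θ p)
    (hσ : SupplierObligations θ p σ) (hT : NoExpansionObligation θ p σ) (w : WorldP) (hC : w.C = (datumOfRecord₁₃CoPH F N θ h).C) :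
    Dag.B14_main (leavesP w p) :=
  b14_main_at_record₁₃CoPH_of_rOpLeaf F N θ p w h hC
    (fun _ => rOpLeaf_VOfRecord₁₃CoPH_of_liveSel_of_rstep F N θ p (fun q j _ hj => h.rstep q j hj) hθ hκ hE₀ hB₀ hsel)
    (fun _ _ _ _ _ _ _ _ => thmP245Laws_of_obligations h hsel hθ hκ hE₀ hB₀ hM σ hσ hT)

/-- **`B16.Thm1Printed (datumOfRecord₁₃CoPH F N θ h).C` FROM A SUPPLIER PER WINDOWED RUN** carrying its obligations along its own chain (def-T's
`thm1Printed_datumOfRecord₁₃CoPH_of_tLaw_rOpLeaf`; the 𝐑-leaf on the live line). [cite: Balaban1988Convergent, Thm 1 p.262, Theorem p.245, p.244; Balaban1989LargeFieldII, Thm 1 p.355 (not exercised); Balaban1989LargeFieldI, (0.3) p.176, p.177 (i)–(ii)] -/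
theorem thm1Printed_datumOfRecord₁₃CoPH_of_obligations (h : θ.Provisos₁₃CoPH F N)
    (hsel : θ.ppSel = ppSelLiveOfRecord F N θ.ν θ.τ9 (EOfRecord₁₃ F N θ.toStage13Params) (wOfRecord₉ F N θ.toStage9Params))
    (hθ : θ.Admissible F N) (hκ : 0 ≤ θ.s2.lf.κ) (hE₀ : 0 ≤ θ.s2.lf.E₀) (hB₀ : 0 ≤ θ.s2.lf.B₀) (hM : 1 ≤ θ.τ9.M) {γ : ℝ} (hγ : 0 < γ)
    (σ : (P : B12.RunParams) → Sect3Supplier θ P)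
    (hσ : ∀ P : B12.RunParams, ((datumOfRecord₁₃CoPH F N θ h).C P).flow.InInterval γ P.K → SupplierObligations θ P (σ P))
    (hT : ∀ P : B12.RunParams, ((datumOfRecord₁₃CoPH F N θ h).C P).flow.InInterval γ P.K → NoExpansionObligation θ P (σ P)) :
    B16.Thm1Printed (datumOfRecord₁₃CoPH F N θ h).C :=
  thm1Printed_datumOfRecord₁₃CoPH_of_tLaw_rOpLeaf F N θ h hγ (fun P hP => thmP245Laws_of_obligations h hsel hθ hκ hE₀ hB₀ hM (σ P) (hσ P hP) (hT P hP))
    (fun P _ => rOpLeaf_VOfRecord₁₃CoPH_of_liveSel_of_rstep F N θ P (fun q j _ hj => h.rstep q j hj) hθ hκ hE₀ hB₀ hsel)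

end Node

/-! ## §2  Theorem 1 along the chain with the no-expansion obligation discharged: from the rows; at any Gaussian certificate from the operand rows alone -/

section Discharged

/-- **THEOREM 1 OF [III] AT `θ`, ALL LEVELS, FROM `SupplierObligations` + THE ROWS** (`ResidualRows θ p` witness-free, `OperandRowsAlongChain θ p σ`; `…ChainRows` read through
the names), live-selector line, core provisos, `ZhUnity`. [cite: Balaban1988Convergent, Thm 1 p.262, Theorem p.245, (3.24)–(3.25) p.270, (3.16)–(3.21) pp.268–269; Balaban1989LargeFieldI, (0.2)–(0.4) p.176, p.177 (i)–(ii)] -/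
theorem sLaw₁₃CoPH_all_of_obligations_of_rows (h : θ.Provisos₁₃CoPH F N) (hU : θ.ZhUnity F N)
    (hsel : θ.ppSel = ppSelLiveOfRecord F N θ.ν θ.τ9 (EOfRecord₁₃ F N θ.toStage13Params) (wOfRecord₉ F N θ.toStage9Params))
    (hθ : θ.Admissible F N) (hκ : 0 ≤ θ.s2.lf.κ) (hE₀ : 0 ≤ θ.s2.lf.E₀) (hB₀ : 0 ≤ θ.s2.lf.B₀) (hM : 1 ≤ θ.τ9.M) (σ : Sect3Supplier θ p)
    (hσ : SupplierObligations θ p σ) (hres : ResidualRows θ p) (hops : OperandRowsAlongChain θ p σ) : ∀ k, k ≤ p.K → SLaw₁₃CoPH F N θ p k :=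
  sLaw₁₃CoPH_all_of_obligations h hsel hθ hκ hE₀ hB₀ hM σ hσ (noExpansionObligation_of_residualRows_of_operandRows h hU hM σ hσ.loc hres hops)

/-- **★★ THEOREM 1 OF [III] AT ANY `θ` OF THE GAUSSIAN CERTIFICATE CLASS, ALL LEVELS, FROM `SupplierObligations` + def-T's OPERAND ROWS ALONG THE CHAIN — NOTHING ELSE of the
no-expansion lane** (certificate `ζ0`, A-fibre Gaussian `quad`; dag-n11-w1's witness-keyed face; no `ZhUnity`, no residual row, no K0b row), live-selector line.
[cite: Balaban1988Convergent, Thm 1 p.262, Theorem p.245, (3.24)–(3.25) p.270, (3.23) p.270; Balaban1989LargeFieldI, (0.2)–(0.4) p.176, p.177 (i)–(ii)] -/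
theorem sLaw₁₃CoPH_all_of_obligations_of_gaussCert
    (hζ : ∀ (p : B12.RunParams) (n : ℕ) (Ω Λ : ℕ → Set (Site (F.P p.K) 0)), (θ.Zh p n Ω Λ).ζ0 = (ZhPinOfRecord₁₃ θ.toStage13Params p Ω Λ).ζ0)
    (hq : ∀ (p : B12.RunParams) (n : ℕ) (Ω Λ : ℕ → Set (Site (F.P p.K) 0)) (j : ℕ) (Λ' : Set (Site (F.P p.K) 0)) (ω : MultiCfg (F.P p.K) (SU N) (FluctV N)),
      (θ.Zh p n Ω Λ).quad j Λ' ω = ∑ b ∈ (Set.toFinite (bondsIn j (Λ'ᶜ ∩ Ω (j + 1)))).toFinset, ‖(ω j).2 b‖ ^ 2)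
    (h : θ.Provisos₁₃CoPH F N)
    (hsel : θ.ppSel = ppSelLiveOfRecord F N θ.ν θ.τ9 (EOfRecord₁₃ F N θ.toStage13Params) (wOfRecord₉ F N θ.toStage9Params))
    (hθ : θ.Admissible F N) (hκ : 0 ≤ θ.s2.lf.κ) (hE₀ : 0 ≤ θ.s2.lf.E₀) (hB₀ : 0 ≤ θ.s2.lf.B₀) (hM : 1 ≤ θ.τ9.M) (σ : Sect3Supplier θ p)
    (hσ : SupplierObligations θ p σ) (hops : OperandRowsAlongChain θ p σ) : ∀ k, k ≤ p.K → SLaw₁₃CoPH F N θ p k :=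
  sLaw₁₃CoPH_all_of_obligations h hsel hθ hκ hE₀ hB₀ hM σ hσ (noExpansionObligation_of_gaussCert_of_operandRows hζ hq h hM σ hσ.loc hops)

/-- **★★ THIS SEAT's R134 ROW AT ANY `θ` OF THE GAUSSIAN CERTIFICATE CLASS**: `B14.ThmP245PrintedI` along any `T`-family agreeing with the tower, from `SupplierObligations` +
def-T's operand rows along the chain — nothing else of the no-expansion lane. [cite: Balaban1988Convergent, Theorem p.245, Thm 1 p.262, remark p.262, (3.25) p.270, (3.23) p.270] -/
theorem thmP245PrintedI_of_obligations_of_gaussCert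
    (hζ : ∀ (p : B12.RunParams) (n : ℕ) (Ω Λ : ℕ → Set (Site (F.P p.K) 0)), (θ.Zh p n Ω Λ).ζ0 = (ZhPinOfRecord₁₃ θ.toStage13Params p Ω Λ).ζ0)
    (hq : ∀ (p : B12.RunParams) (n : ℕ) (Ω Λ : ℕ → Set (Site (F.P p.K) 0)) (j : ℕ) (Λ' : Set (Site (F.P p.K) 0)) (ω : MultiCfg (F.P p.K) (SU N) (FluctV N)),
      (θ.Zh p n Ω Λ).quad j Λ' ω = ∑ b ∈ (Set.toFinite (bondsIn j (Λ'ᶜ ∩ Ω (j + 1)))).toFinset, ‖(ω j).2 b‖ ^ 2)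
    (h : θ.Provisos₁₃CoPH F N)
    (hsel : θ.ppSel = ppSelLiveOfRecord F N θ.ν θ.τ9 (EOfRecord₁₃ F N θ.toStage13Params) (wOfRecord₉ F N θ.toStage9Params))
    (hθ : θ.Admissible F N) (hκ : 0 ≤ θ.s2.lf.κ) (hE₀ : 0 ≤ θ.s2.lf.E₀) (hB₀ : 0 ≤ θ.s2.lf.B₀) (hM : 1 ≤ θ.τ9.M) (σ : Sect3Supplier θ p)
    (hσ : SupplierObligations θ p σ) (hops : OperandRowsAlongChain θ p σ)
    (T : (k : ℕ) → RTOpI (F.P p.K) k (SU N) (avOfRecord F N p.K k))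
    (hTT : ∀ k, k < p.K → (T k).T (densOfRecord₁₃ F N θ.toStage13Params p k) = tdensOfRecord₁₃ F N θ.toStage13Params p k) :
    B14.ThmP245PrintedI T (densOfRecord₁₃ F N θ.toStage13Params p) (VOfRecord₁₃CoPH F N θ p).S (VOfRecord₁₃CoPH F N θ p).Scorr p.K :=
  thmP245PrintedI_of_obligations h hsel hθ hκ hE₀ hB₀ hM σ hσ (noExpansionObligation_of_gaussCert_of_operandRows hζ hq h hM σ hσ.loc hops) T hTT

/-- **★★ THEOREM 1 OF [III] AT THE NAMED GAUSSIAN CERTIFICATE `gaussPinH θ` OF ANY `θ` WITH CORE PROVISOS ON ITS LIVE-SELECTOR LINE** (dag-n11-w1's `gaussPinH`, its `rfl`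
class faces and `provisos₁₃CoPH_gaussPinH`; the Stage-13 part of `gaussPinH θ` IS `θ`'s, so the selector clause, admissibility and the signs are `θ`'s): from a supplier AT
`gaussPinH θ` with its obligations + def-T's operand rows along its chain. [cite: Balaban1988Convergent, Thm 1 p.262, Theorem p.245, (3.23)–(3.25) p.270, (2.21) p.258; Balaban1989LargeFieldI, (0.2)–(0.4) p.176] -/
theorem sLaw₁₃CoPH_all_gaussPinH_of_obligations (h : θ.Provisos₁₃CoPH F N)
    (hsel : θ.ppSel = ppSelLiveOfRecord F N θ.ν θ.τ9 (EOfRecord₁₃ F N θ.toStage13Params) (wOfRecord₉ F N θ.toStage9Params))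
    (hθ : θ.Admissible F N) (hκ : 0 ≤ θ.s2.lf.κ) (hE₀ : 0 ≤ θ.s2.lf.E₀) (hB₀ : 0 ≤ θ.s2.lf.B₀) (hM : 1 ≤ θ.τ9.M) (σ : Sect3Supplier (gaussPinH θ) p)
    (hσ : SupplierObligations (gaussPinH θ) p σ) (hops : OperandRowsAlongChain (gaussPinH θ) p σ) : ∀ k, k ≤ p.K → SLaw₁₃CoPH F N (gaussPinH θ) p k :=
  sLaw₁₃CoPH_all_of_obligations_of_gaussCert (gaussPinH_ζ0 θ) (gaussPinH_quad θ) (provisos₁₃CoPH_gaussPinH h) hsel hθ hκ hE₀ hB₀ hM σ hσ hops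

end Discharged

/-! ## §3  At the H-extensions of the witness of record: selector, admissibility, signs and `M = 1` discharged -/

section Record

variable (F N)
variable {Zr : (q : B12.RunParams) → TkResidualW F N (FluctV N) q.K}
  {Zh : (q : B12.RunParams) → ℕ → (ℕ → Set (Site (F.P q.K) 0)) → (ℕ → Set (Site (F.P q.K) 0)) → TkResidualW F N (FluctV N) q.K}
  {Phih : (q : B12.RunParams) → ℕ → (ℕ → Set (Site (F.P q.K) 0)) → (ℕ → Set (Site (F.P q.K) 0)) → (ℕ → Plaq (F.P q.K) 0 → ℝ)} (p : B12.RunParams)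

/-- **★ THEOREM 1 OF [III] AT ANY H-EXTENSION `⟨⟨θ₁₃, Zr⟩, Zh, Phih⟩` OF THE WITNESS OF RECORD `θ₁₃ = theta13LiveOfRecord F N`, ALL LEVELS, ALL HISTORIES, FROM `hrec` (the core
provisos of the extension — the datum's key), THE SUPPLIER's OBLIGATIONS ALONG ITS CHAIN AND THE NO-EXPANSION OBLIGATION — NOTHING ELSE**: the selector clause is `rfl`
(K0a's live re-pin), admissibility is `admissible_theta13LiveOfRecord`, `0 ≤ κ, E₀, B₀` and `M = 1` are the family's numerals.
[cite: Balaban1988Convergent, Thm 1 p.262, Theorem p.245, p.244, (3.24)–(3.25) p.270, (1.11) p.248, (3.16)–(3.22) pp.268–269; Balaban1989LargeFieldI, (0.3)–(0.4) p.176, p.177 (i)–(ii)] -/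
theorem sLaw₁₃CoPH_all_theta13LiveOfRecordH_of_obligations
    (hrec : (⟨⟨theta13LiveOfRecord F N, Zr⟩, Zh, Phih⟩ : Stage13HParams F N).Provisos₁₃CoPH F N)
    (σ : Sect3Supplier (⟨⟨theta13LiveOfRecord F N, Zr⟩, Zh, Phih⟩ : Stage13HParams F N) p)
    (hσ : SupplierObligations (⟨⟨theta13LiveOfRecord F N, Zr⟩, Zh, Phih⟩ : Stage13HParams F N) p σ)
    (hT : NoExpansionObligation (⟨⟨theta13LiveOfRecord F N, Zr⟩, Zh, Phih⟩ : Stage13HParams F N) p σ) :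
    ∀ k, k ≤ p.K → SLaw₁₃CoPH F N (⟨⟨theta13LiveOfRecord F N, Zr⟩, Zh, Phih⟩ : Stage13HParams F N) p k :=
  sLaw₁₃CoPH_all_of_obligations hrec rfl (admissible_theta13LiveOfRecord F N)
    (kappa_nonneg_theta13LiveOfFamily F N eps0OfRecord₁₃ (zeta316OfRecord F N (numerics7OfFamily eps0OfRecord₁₃) 1 1) (RzOfRecord F N) (ZtOfRecord F N))
    (E0_nonneg_theta13LiveOfFamily F N eps0OfRecord₁₃ (zeta316OfRecord F N (numerics7OfFamily eps0OfRecord₁₃) 1 1) (RzOfRecord F N) (ZtOfRecord F N))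
    (B0_nonneg_theta13LiveOfFamily F N eps0OfRecord₁₃ (zeta316OfRecord F N (numerics7OfFamily eps0OfRecord₁₃) 1 1) (RzOfRecord F N) (ZtOfRecord F N))
    (le_of_eq rfl) σ hσ hT

/-- **★ THE 𝐓-IMAGES `∀ k < K, TLaw₁₃CoPH … p k` AT ANY H-EXTENSION OF THE WITNESS OF RECORD FROM `hrec`, `hσ`, `hT` — NOTHING ELSE.**
[cite: Balaban1988Convergent, Theorem p.245, remark p.262, §3 p.279, (3.25) p.270; Balaban1989LargeFieldI, (0.3)–(0.4) p.176] -/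
theorem tLaw₁₃CoPH_all_theta13LiveOfRecordH_of_obligations
    (hrec : (⟨⟨theta13LiveOfRecord F N, Zr⟩, Zh, Phih⟩ : Stage13HParams F N).Provisos₁₃CoPH F N)
    (σ : Sect3Supplier (⟨⟨theta13LiveOfRecord F N, Zr⟩, Zh, Phih⟩ : Stage13HParams F N) p)
    (hσ : SupplierObligations (⟨⟨theta13LiveOfRecord F N, Zr⟩, Zh, Phih⟩ : Stage13HParams F N) p σ)
    (hT : NoExpansionObligation (⟨⟨theta13LiveOfRecord F N, Zr⟩, Zh, Phih⟩ : Stage13HParams F N) p σ) :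
    ∀ k, k < p.K → TLaw₁₃CoPH F N (⟨⟨theta13LiveOfRecord F N, Zr⟩, Zh, Phih⟩ : Stage13HParams F N) p k :=
  tLaw₁₃CoPH_all_of_obligations hrec rfl (admissible_theta13LiveOfRecord F N)
    (kappa_nonneg_theta13LiveOfFamily F N eps0OfRecord₁₃ (zeta316OfRecord F N (numerics7OfFamily eps0OfRecord₁₃) 1 1) (RzOfRecord F N) (ZtOfRecord F N))
    (E0_nonneg_theta13LiveOfFamily F N eps0OfRecord₁₃ (zeta316OfRecord F N (numerics7OfFamily eps0OfRecord₁₃) 1 1) (RzOfRecord F N) (ZtOfRecord F N))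
    (B0_nonneg_theta13LiveOfFamily F N eps0OfRecord₁₃ (zeta316OfRecord F N (numerics7OfFamily eps0OfRecord₁₃) 1 1) (RzOfRecord F N) (ZtOfRecord F N))
    (le_of_eq rfl) σ hσ hT

/-- **★ (HOME TRIGGERS (t60)) THEOREM 1 OF [III] AT ANY H-EXTENSION OF THE WITNESS OF RECORD, ALL LEVELS, FROM `hrec`, `ZhUnity`, THE SUPPLIER's OBLIGATIONS AND THE ROWS**
(`ResidualRows` witness-free — pins, measurability, K0b's A-fibre domination; `OperandRowsAlongChain` — def-T) — the record-door corollary of `…ChainRows` §2 with the selector,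
admissibility, the signs and `M = 1` discharged. [cite: Balaban1988Convergent, Thm 1 p.262, Theorem p.245, (3.24)–(3.25) p.270, (3.16)–(3.22) pp.268–269, (1.11) p.248; Balaban1989LargeFieldI, (0.3)–(0.4) p.176, p.177 (i)–(ii)] -/
theorem sLaw₁₃CoPH_all_theta13LiveOfRecordH_of_obligations_of_rows
    (hrec : (⟨⟨theta13LiveOfRecord F N, Zr⟩, Zh, Phih⟩ : Stage13HParams F N).Provisos₁₃CoPH F N)
    (hU : (⟨⟨theta13LiveOfRecord F N, Zr⟩, Zh, Phih⟩ : Stage13HParams F N).ZhUnity F N)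
    (σ : Sect3Supplier (⟨⟨theta13LiveOfRecord F N, Zr⟩, Zh, Phih⟩ : Stage13HParams F N) p)
    (hσ : SupplierObligations (⟨⟨theta13LiveOfRecord F N, Zr⟩, Zh, Phih⟩ : Stage13HParams F N) p σ)
    (hres : ResidualRows (⟨⟨theta13LiveOfRecord F N, Zr⟩, Zh, Phih⟩ : Stage13HParams F N) p)
    (hops : OperandRowsAlongChain (⟨⟨theta13LiveOfRecord F N, Zr⟩, Zh, Phih⟩ : Stage13HParams F N) p σ) :
    ∀ k, k ≤ p.K → SLaw₁₃CoPH F N (⟨⟨theta13LiveOfRecord F N, Zr⟩, Zh, Phih⟩ : Stage13HParams F N) p k :=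
  sLaw₁₃CoPH_all_theta13LiveOfRecordH_of_obligations F N p hrec σ hσ
    (noExpansionObligation_of_residualRows_of_operandRows hrec hU (le_of_eq rfl) σ hσ.loc hres hops)

/-- **★★★ THE HONEST STATE OF N11 AT A GAUSSIAN DOOR OF THE WITNESS OF RECORD, WITNESS-THREADED**: at any H-extension `⟨⟨θ₁₃, Zr⟩, Zh, Phih⟩` of `θ₁₃ = theta13LiveOfRecord F N`
whose `Zh` carries the certificate's `ζ0` and the A-fibre Gaussian `quad` (e.g. `gaussPinH` of the history-blind door of K0a's cured witness), THEOREM 1 OF [III], ALL LEVELS, ALL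
HISTORIES, holds FROM `hrec` (the datum's key), `SupplierObligations` ([III] §3, along the supplier's OWN chain) and `OperandRowsAlongChain` (def-T) — AND NOTHING ELSE: no
`ZhUnity`, no residual row, no K0b row, no selector ∕ admissibility ∕ sign hypothesis.  The witness-threaded twin of dag-n11-w1's
`sLaw₁₃CoPH_all_gaussCertH_doorCured_theta13LiveOfRecord_of_operandRows_of_supply` (which quantified the operand rows and the supply over EVERY exposed witness).
[cite: Balaban1988Convergent, Thm 1 p.262, Theorem p.245, p.244, (3.23)–(3.25) p.270, (1.11) p.248, (3.16)–(3.22) pp.268–269; Balaban1989LargeFieldI, (0.3)–(0.4) p.176, p.177 (i)–(ii)] -/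
theorem sLaw₁₃CoPH_all_gaussCertH_theta13LiveOfRecord_of_obligations_of_operandRows
    (hζ : ∀ (p : B12.RunParams) (n : ℕ) (Ω Λ : ℕ → Set (Site (F.P p.K) 0)), (Zh p n Ω Λ).ζ0 = (ZhPinOfRecord₁₃ (theta13LiveOfRecord F N) p Ω Λ).ζ0)
    (hq : ∀ (p : B12.RunParams) (n : ℕ) (Ω Λ : ℕ → Set (Site (F.P p.K) 0)) (j : ℕ) (Λ' : Set (Site (F.P p.K) 0)) (ω : MultiCfg (F.P p.K) (SU N) (FluctV N)),
      (Zh p n Ω Λ).quad j Λ' ω = ∑ b ∈ (Set.toFinite (bondsIn j (Λ'ᶜ ∩ Ω (j + 1)))).toFinset, ‖(ω j).2 b‖ ^ 2)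
    (hrec : (⟨⟨theta13LiveOfRecord F N, Zr⟩, Zh, Phih⟩ : Stage13HParams F N).Provisos₁₃CoPH F N)
    (σ : Sect3Supplier (⟨⟨theta13LiveOfRecord F N, Zr⟩, Zh, Phih⟩ : Stage13HParams F N) p)
    (hσ : SupplierObligations (⟨⟨theta13LiveOfRecord F N, Zr⟩, Zh, Phih⟩ : Stage13HParams F N) p σ)
    (hops : OperandRowsAlongChain (⟨⟨theta13LiveOfRecord F N, Zr⟩, Zh, Phih⟩ : Stage13HParams F N) p σ) :
    ∀ k, k ≤ p.K → SLaw₁₃CoPH F N (⟨⟨theta13LiveOfRecord F N, Zr⟩, Zh, Phih⟩ : Stage13HParams F N) p k :=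
  sLaw₁₃CoPH_all_theta13LiveOfRecordH_of_obligations F N p hrec σ hσ
    (noExpansionObligation_of_gaussCert_of_operandRows hζ hq hrec (le_of_eq rfl) σ hσ.loc hops)

/-- **★★ `B16.Thm1Printed` AT THE CoPH DATUM OF ANY H-EXTENSION OF THE WITNESS OF RECORD (`hrec` only the datum's key) FROM A SUPPLIER PER WINDOWED RUN carrying its
obligations along its own chain + the no-expansion obligation — NOTHING ELSE** (the knit's `thm1Printed_datumOfRecord₁₃CoPH_theta13LiveOfRecord_of_thmP245I`, whose `ROpLeaf`
is CLOSED, over §1's law form; any `T`-family agreeing with the tower serves — the conclusion is `T`-free).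
[cite: Balaban1988Convergent, Theorem p.245, Thm 1 p.262, p.244; Balaban1989LargeFieldII, Thm 1 p.355; Balaban1989LargeFieldI, (0.3) p.176, p.177 (i)–(ii)] -/
theorem thm1Printed_datumOfRecord₁₃CoPH_theta13LiveOfRecordH_of_obligations
    (hrec : (⟨⟨theta13LiveOfRecord F N, Zr⟩, Zh, Phih⟩ : Stage13HParams F N).Provisos₁₃CoPH F N) {γ : ℝ} (hγ : 0 < γ)
    (T : (P : B12.RunParams) → (k : ℕ) → RTOpI (F.P P.K) k (SU N) (avOfRecord F N P.K k))
    (hTT : ∀ (P : B12.RunParams) (k : ℕ), k < P.K →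
      (T P k).T (densOfRecord₁₃ F N (theta13LiveOfRecord F N) P k) = tdensOfRecord₁₃ F N (theta13LiveOfRecord F N) P k)
    (σ : (P : B12.RunParams) → Sect3Supplier (⟨⟨theta13LiveOfRecord F N, Zr⟩, Zh, Phih⟩ : Stage13HParams F N) P)
    (hσ : ∀ P : B12.RunParams, ((datumOfRecord₁₃CoPH F N (⟨⟨theta13LiveOfRecord F N, Zr⟩, Zh, Phih⟩ : Stage13HParams F N) hrec).C P).flow.InInterval γ P.K →
      SupplierObligations (⟨⟨theta13LiveOfRecord F N, Zr⟩, Zh, Phih⟩ : Stage13HParams F N) P (σ P))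
    (hT : ∀ P : B12.RunParams, ((datumOfRecord₁₃CoPH F N (⟨⟨theta13LiveOfRecord F N, Zr⟩, Zh, Phih⟩ : Stage13HParams F N) hrec).C P).flow.InInterval γ P.K →
      NoExpansionObligation (⟨⟨theta13LiveOfRecord F N, Zr⟩, Zh, Phih⟩ : Stage13HParams F N) P (σ P)) :
    B16.Thm1Printed (datumOfRecord₁₃CoPH F N (⟨⟨theta13LiveOfRecord F N, Zr⟩, Zh, Phih⟩ : Stage13HParams F N) hrec).C :=
  thm1Printed_datumOfRecord₁₃CoPH_theta13LiveOfRecord_of_thmP245I F N Zr Zh Phih hrec hγ T hTT fun P hP =>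
    (thmP245PrintedI_at_record₁₃CoPH_iff_laws F N (⟨⟨theta13LiveOfRecord F N, Zr⟩, Zh, Phih⟩ : Stage13HParams F N) P (T P) (hTT P)).2
      (thmP245Laws_of_obligations hrec rfl (admissible_theta13LiveOfRecord F N)
        (kappa_nonneg_theta13LiveOfFamily F N eps0OfRecord₁₃ (zeta316OfRecord F N (numerics7OfFamily eps0OfRecord₁₃) 1 1) (RzOfRecord F N) (ZtOfRecord F N))
        (E0_nonneg_theta13LiveOfFamily F N eps0OfRecord₁₃ (zeta316OfRecord F N (numerics7OfFamily eps0OfRecord₁₃) 1 1) (RzOfRecord F N) (ZtOfRecord F N))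
        (B0_nonneg_theta13LiveOfFamily F N eps0OfRecord₁₃ (zeta316OfRecord F N (numerics7OfFamily eps0OfRecord₁₃) 1 1) (RzOfRecord F N) (ZtOfRecord F N))
        (le_of_eq rfl) (σ P) (hσ P hP) (hT P hP))

end Record

end Summit.QuantumFields.YangMills.Theorems.BalabanUVNodesN11Sect3SupplyChainNode

end
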